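import Mathlib

/-!
# Stub `stub_normalFormGlue` — line `atkinson-lloyd-core-split`, crux `HiddenCornerLemmaR`

Pure bookkeeping: the two halves of Atkinson–Lloyd's Theorem 1 — the reduction of a bounded-rank
space of matrices to border rows / border columns / a PRIMITIVE core (hypothesis (A)) and the size
bound `2·#rows, 2·#cols ≤ ρ(ρ+1)` for primitive spaces of exact upper rank `ρ` (hypothesis (B)) —
give the normal form with size bounds consumed by the composition (conclusion (C)).

* Size bounds: the core space `{(P M Q)|_{CR × CC} : M ∈ V}` is the `Submodule.map` of the linear
  map `M ↦ (P M Q)|_{CR × CC}`; (B) is applied to it with `ι := ↥CR`, `κ := ↥CC`.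
* Blanked rank: by the support clause the blanked matrix (border rows and columns set to zero)
  vanishes outside `CR × CC`, hence equals `E_R · core · E_C` for the `0/1` extension matrices,
  so its rank is at most the rank of the core.
-/

set_option linter.dupNamespace false

namespace Summit.MatrixMultiplication.MatrixMultiplication.Cruxes.HiddenCornerLemmaR.AtkinsonLloydCoreSplit

open Matrix

/-- Left multiplication by the `0/1` row-extension matrix of a finset `CR` of row indices is
extension by zero of the rows: row `i` of the product is row `⟨i, _⟩` of `X` if `i ∈ CR` and
zero otherwise. -/
private theorem rowExt_mul_apply {m : ℕ} {κ : Type*} [Fintype κ] (CR : Finset (Fin m))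
    (X : Matrix CR κ ℂ) (i : Fin m) (j : κ) :
    ((Matrix.of fun (i : Fin m) (i' : CR) => if i = (i' : Fin m) then (1 : ℂ) else 0) * X) i j =
      if h : i ∈ CR then X ⟨i, h⟩ j else 0 := by
  rw [Matrix.mul_apply]
  split_ifs with h
  · rw [Finset.sum_eq_single (⟨i, h⟩ : CR)]
    · simp
    · intro b _ hb
      have hne : i ≠ (b : Fin m) := fun h' => hb (Subtype.ext h'.symm)
      simp [hne]
    · intro h'
      exact absurd (Finset.mem_univ _) h'
  · refine Finset.sum_eq_zero fun b _ => ?_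
    have hne : i ≠ (b : Fin m) := fun h' => h (h' ▸ b.2)
    simp [hne]

/-- Right multiplication by the `0/1` column-extension matrix of a finset `CC` of column indices
is extension by zero of the columns: column `j` of the product is column `⟨j, _⟩` of `X` if
`j ∈ CC` and zero otherwise. -/
private theorem mul_colExt_apply {n : ℕ} {ι : Type*} (CC : Finset (Fin n))
    (X : Matrix ι CC ℂ) (i : ι) (j : Fin n) :
    (X * (Matrix.of fun (j' : CC) (j : Fin n) => if (j' : Fin n) = j then (1 : ℂ) else 0)) i j =
      if h : j ∈ CC then X i ⟨j, h⟩ else 0 := by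
  rw [Matrix.mul_apply]
  split_ifs with h
  · rw [Finset.sum_eq_single (⟨j, h⟩ : CC)]
    · simp
    · intro b _ hb
      have hne : (b : Fin n) ≠ j := fun h' => hb (Subtype.ext h')
      simp [hne]
    · intro h'
      exact absurd (Finset.mem_univ _) h'
  · refine Finset.sum_eq_zero fun b _ => ?_
    have hne : (b : Fin n) ≠ j := fun h' => h (h' ▸ b.2)
    simp [hne]

/-- **stub 1c — `stub_normalFormGlue`: the two halves of Atkinson–Lloyd's Theorem 1 give the
normal form used by the composition.**  Hypothesis (A) is the Atkinson–Lloyd reduction to a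
primitive core (border rows `BR`, border columns `BC`, core window `CR × CC` of exact upper rank
`ρ`, primitivity spelled out as four explicit conditions); hypothesis (B) is the size bound for
primitive spaces over arbitrary finite index types.  Conclusion: the normal form with
`2·#CR, 2·#CC ≤ ρ(ρ+1)` and the blanked full-size matrix (border rows and columns set to zero)
of rank `≤ ρ` throughout `V`.  Proof: the core space is the `Submodule.map` of the linear map
`M ↦ (P M Q)|_{CR × CC}`, to which (B) applies verbatim; the blanked matrix vanishes outside
`CR × CC` by the support clause, so it is `E_R · core · E_C` with `0/1` extension matrices and
`Matrix.rank_mul_le_left` / `Matrix.rank_mul_le_right` bound its rank by that of the core. -/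
theorem stub_normalFormGlue :
    (∀ (m n d : ℕ) (V : Submodule ℂ (Matrix (Fin m) (Fin n) ℂ)), (∀ M ∈ V, M.rank ≤ d) →
      ∃ (P : Matrix (Fin m) (Fin m) ℂ) (Q : Matrix (Fin n) (Fin n) ℂ), IsUnit P ∧ IsUnit Q ∧
        ∃ (BR CR : Finset (Fin m)) (BC CC : Finset (Fin n)) (ρ : ℕ),
          Disjoint BR CR ∧ Disjoint BC CC ∧ BR.card + BC.card + ρ ≤ d ∧
          (∀ M ∈ V, ∀ (i : Fin m) (j : Fin n), (P * M * Q) i j ≠ 0 →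
            i ∈ BR ∨ j ∈ BC ∨ (i ∈ CR ∧ j ∈ CC)) ∧
          (∀ M ∈ V, ((P * M * Q).submatrix (fun i : CR => (i : Fin m)) (fun j : CC => (j : Fin n))).rank ≤ ρ) ∧
          (∃ M ∈ V, ((P * M * Q).submatrix (fun i : CR => (i : Fin m)) (fun j : CC => (j : Fin n))).rank = ρ) ∧
          (∀ w : CR → ℂ, (∀ M ∈ V, Matrix.vecMul w
            ((P * M * Q).submatrix (fun i : CR => (i : Fin m)) (fun j : CC => (j : Fin n))) = 0) → w = 0) ∧
          (∀ v : CC → ℂ, (∀ M ∈ V, Matrix.mulVec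
            ((P * M * Q).submatrix (fun i : CR => (i : Fin m)) (fun j : CC => (j : Fin n))) v = 0) → v = 0) ∧
          (∀ φ : CC → ℂ, φ ≠ 0 → ∃ M ∈ V, ∃ B : Matrix CC (Fin ρ) ℂ, Matrix.vecMul φ B = 0 ∧
            (((P * M * Q).submatrix (fun i : CR => (i : Fin m)) (fun j : CC => (j : Fin n))) * B).rank = ρ) ∧
          (∀ ψ : CR → ℂ, ψ ≠ 0 → ∃ M ∈ V, ∃ C : Matrix (Fin ρ) CR ℂ, Matrix.mulVec C ψ = 0 ∧
            (C * ((P * M * Q).submatrix (fun i : CR => (i : Fin m)) (fun j : CC => (j : Fin n)))).rank = ρ)) →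
    (∀ (ι κ : Type) [Fintype ι] [Fintype κ] [DecidableEq ι] [DecidableEq κ]
      (Y : Submodule ℂ (Matrix ι κ ℂ)) (ρ : ℕ),
      (∀ A ∈ Y, A.rank ≤ ρ) → (∃ A ∈ Y, A.rank = ρ) →
      (∀ w : ι → ℂ, (∀ A ∈ Y, Matrix.vecMul w A = 0) → w = 0) →
      (∀ v : κ → ℂ, (∀ A ∈ Y, Matrix.mulVec A v = 0) → v = 0) →
      (∀ φ : κ → ℂ, φ ≠ 0 → ∃ A ∈ Y, ∃ B : Matrix κ (Fin ρ) ℂ, Matrix.vecMul φ B = 0 ∧ (A * B).rank = ρ) →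
      (∀ ψ : ι → ℂ, ψ ≠ 0 → ∃ A ∈ Y, ∃ C : Matrix (Fin ρ) ι ℂ, Matrix.mulVec C ψ = 0 ∧ (C * A).rank = ρ) →
      2 * Fintype.card ι ≤ ρ * (ρ + 1) ∧ 2 * Fintype.card κ ≤ ρ * (ρ + 1)) →
    ∀ (m n d : ℕ) (V : Submodule ℂ (Matrix (Fin m) (Fin n) ℂ)), (∀ M ∈ V, M.rank ≤ d) →
    ∃ (P : Matrix (Fin m) (Fin m) ℂ) (Q : Matrix (Fin n) (Fin n) ℂ), IsUnit P ∧ IsUnit Q ∧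
      ∃ (BR CR : Finset (Fin m)) (BC CC : Finset (Fin n)) (ρ : ℕ),
        Disjoint BR CR ∧ Disjoint BC CC ∧ BR.card + BC.card + ρ ≤ d ∧
        2 * CR.card ≤ ρ * (ρ + 1) ∧ 2 * CC.card ≤ ρ * (ρ + 1) ∧
        (∀ M ∈ V, ∀ (i : Fin m) (j : Fin n), (P * M * Q) i j ≠ 0 →
          i ∈ BR ∨ j ∈ BC ∨ (i ∈ CR ∧ j ∈ CC)) ∧
        (∀ M ∈ V, (Matrix.of fun (i : Fin m) (j : Fin n) =>
          if i ∈ BR ∨ j ∈ BC then (0 : ℂ) else (P * M * Q) i j).rank ≤ ρ) := by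
  intro hA hB m n d V hV
  obtain ⟨P, Q, hP, hQ, BR, CR, BC, CC, ρ, hdisj₁, hdisj₂, hcard, hsupp, hcoreRank, hcoreExact,
    hleft, hright, hiii, hiv⟩ := hA m n d V hV
  -- the core map `M ↦ (P M Q)|_{CR × CC}` is linear
  obtain ⟨f, hf⟩ : ∃ f : Matrix (Fin m) (Fin n) ℂ →ₗ[ℂ] Matrix CR CC ℂ, ∀ M,
      f M = (P * M * Q).submatrix (fun i : CR => (i : Fin m)) (fun j : CC => (j : Fin n)) :=
    ⟨{ toFun := fun M =>
          (P * M * Q).submatrix (fun i : CR => (i : Fin m)) (fun j : CC => (j : Fin n))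
       map_add' := fun M₁ M₂ => by
         ext i j
         simp [Matrix.mul_add, Matrix.add_mul]
       map_smul' := fun c M => by
         ext i j
         simp [Matrix.mul_smul, Matrix.smul_mul] },
      fun _ => rfl⟩
  -- size bounds: hypothesis (B) applied to the core space `V.map f`
  have hsize : 2 * Fintype.card CR ≤ ρ * (ρ + 1) ∧ 2 * Fintype.card CC ≤ ρ * (ρ + 1) := by
    refine hB CR CC (V.map f) ρ ?_ ?_ ?_ ?_ ?_ ?_
    · intro A hA'
      obtain ⟨M, hM, rfl⟩ := Submodule.mem_map.1 hA'
      rw [hf]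
      exact hcoreRank M hM
    · obtain ⟨M, hM, hMρ⟩ := hcoreExact
      exact ⟨f M, Submodule.mem_map_of_mem hM, by rw [hf]; exact hMρ⟩
    · intro w hw
      refine hleft w fun M hM => ?_
      have h := hw (f M) (Submodule.mem_map_of_mem hM)
      rwa [hf] at h
    · intro v hv
      refine hright v fun M hM => ?_
      have h := hv (f M) (Submodule.mem_map_of_mem hM)
      rwa [hf] at h
    · intro φ hφ
      obtain ⟨M, hM, B, hB₁, hB₂⟩ := hiii φ hφ
      exact ⟨f M, Submodule.mem_map_of_mem hM, B, hB₁, by rw [hf]; exact hB₂⟩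
    · intro ψ hψ
      obtain ⟨M, hM, C, hC₁, hC₂⟩ := hiv ψ hψ
      exact ⟨f M, Submodule.mem_map_of_mem hM, C, hC₁, by rw [hf]; exact hC₂⟩
  simp only [Fintype.card_coe] at hsize
  refine ⟨P, Q, hP, hQ, BR, CR, BC, CC, ρ, hdisj₁, hdisj₂, hcard, hsize.1, hsize.2, hsupp, ?_⟩
  -- blanked rank: the blanked matrix is `E_R * core * E_C`
  intro M hM
  have key : (Matrix.of fun (i : Fin m) (j : Fin n) =>
        if i ∈ BR ∨ j ∈ BC then (0 : ℂ) else (P * M * Q) i j) =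
      (Matrix.of fun (i : Fin m) (i' : CR) => if i = (i' : Fin m) then (1 : ℂ) else 0) *
        (P * M * Q).submatrix (fun i : CR => (i : Fin m)) (fun j : CC => (j : Fin n)) *
        (Matrix.of fun (j' : CC) (j : Fin n) => if (j' : Fin n) = j then (1 : ℂ) else 0) := by
    ext i j
    rw [mul_colExt_apply, Matrix.of_apply]
    by_cases hj : j ∈ CC
    · rw [dif_pos hj, rowExt_mul_apply]
      by_cases hi : i ∈ CR
      · rw [dif_pos hi, Matrix.submatrix_apply]
        have hiBR : i ∉ BR := fun h => Finset.disjoint_left.1 hdisj₁ h hi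
        have hjBC : j ∉ BC := fun h => Finset.disjoint_left.1 hdisj₂ h hj
        simp [hiBR, hjBC]
      · rw [dif_neg hi]
        split_ifs with hij
        · rfl
        · by_contra hne
          rcases hsupp M hM i j hne with h | h | ⟨h, _⟩
          · exact hij (Or.inl h)
          · exact hij (Or.inr h)
          · exact hi h
    · rw [dif_neg hj]
      split_ifs with hij
      · rfl
      · by_contra hne
        rcases hsupp M hM i j hne with h | h | ⟨_, h⟩
        · exact hij (Or.inl h)
        · exact hij (Or.inr h)
        · exact hj h
  rw [key]
  calc _ ≤ ((Matrix.of fun (i : Fin m) (i' : CR) => if i = (i' : Fin m) then (1 : ℂ) else 0) *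
          (P * M * Q).submatrix (fun i : CR => (i : Fin m)) (fun j : CC => (j : Fin n))).rank :=
        Matrix.rank_mul_le_left _ _
    _ ≤ ((P * M * Q).submatrix (fun i : CR => (i : Fin m)) (fun j : CC => (j : Fin n))).rank :=
        Matrix.rank_mul_le_right _ _
    _ ≤ ρ := hcoreRank M hM

end Summit.MatrixMultiplication.MatrixMultiplication.Cruxes.HiddenCornerLemmaR.AtkinsonLloydCoreSplit
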